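import Summits.QuantumFields.BalabanUV.T4Continuum.Spine.NE1p.DressedSmallFieldOnCoresSlotLettersMass

/-!
# T⁴ programme, spine estimate NE1′ (node O3b/H2) — THE CENTRE CONDITIONS REDUCE TO COERCIVITY FOR A HERMITIAN CENTRE READING: of S30's four
# displayed centre clauses (entries `≤ β₀`, determinant REAL, real part `≥ d₀`, `γ`-coercivity) the two determinant clauses FOLLOW, with
# `d₀ := γ^{card mI}`, from Hermitian symmetry + coercivity of the centre reading (eigenvalues `≥ γ`, `det = Π eigenvalues`) — in kernel

Cell `pub-balaban`, sub-cell `t4`, BINDER-OWNERS row NE1′ (owner lineage t4-ne1p-p1); crew seat `b2b-balaban-t4-ne1p-formalise-leaf-01` (LEAF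
PROVER 01, gen 12); crew row S35 ∕ DAG N29zzf (INTENT `CLAIMS.log` 2026-08-20T17:51:33Z; typer R-T124 (iii), X150).  ADDITIVE — imports crew row S32 `Spine/NE1p/DressedSmallFieldOnCoresSlotLettersMass`
(p229529; ⇒ S30 p228879 ⇒ N0r ⇒ …; ⇒ the substrate's `SubstrateGaussianLettersBall` ∕ `SubstrateSlotsOfRecord`, row NE5's `B13TermCoreMass`) ONLY;
THEOREMS ONLY (0 `def`, 0 `def … : Prop`, 0 cite); nothing of S30 ∕ S32 ∕ N0p–N0r ∕ row NE5 ∕ the substrate restated — used BY NAME; Mathlib's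
`Matrix.IsHermitian.eigenvalues_eq` ∕ `eigenvectorBasis` ∕ `det_eq_prod_eigenvalues` BY NAME.

WHY THIS FILE.  S30 relocated N0r's operator-letter blocks into the substrate's scalar CENTRE CONDITIONS `hctr` — per level `k`, window point
`g ∈ W`, background `U`, factor `(Z′, j)` and contour parameter `a`, at the class centre `c = (ctr k g U).1`: (i) the entries of the affine
reading `A(c,a) = linForm base rd c a` are bounded by `β₀`; (ii) `det A(c,a)` is REAL; (iii) `d₀ ≤ Re det A(c,a)`; (iv) `A(c,a)` is `γ`-coercive
(`γ·Σ|x_i|² ≤ Re⟨x, A(c,a)x⟩` for complex `x`) — plus `hd₀ : 0 < d₀` and the determinant-budget smallness `hbud : detBudget (card mI) β₀ ϑ (R′ k) < d₀`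
(p3's `det_linForm_mem_slitPlane` ∕ `norm_det_linForm_le` take (ii)–(iii) as hypotheses).  For a HERMITIAN centre reading — the TYPE of
[Balaban1988RGII]'s covariances `C^{(k)}(Z₀,σ)`, `Γ_k` at a REAL background: real symmetric ((2.15)–(2.17) KIND; which tables realise them is the
substrate's displayed identification) — clauses (ii) and (iii) are CONSEQUENCES of (iv): every eigenvalue of a Hermitian `γ`-coercive matrix
is a Rayleigh quotient at a unit eigenvector, hence `≥ γ`, and the determinant is the product of the eigenvalues, hence REAL and `≥ γ^{card}`
(finite-dimensional spectral theorem, Mathlib).  THIS FILE proves that lemma and re-runs S32's two ENDs with the centre conditions so reduced: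
* §1 (kernel, [folklore] linear algebra) `nsq_coe_euclidean` (`nsq ⇑v = ‖v‖²` on `EuclideanSpace ℂ m`), **`det_im_eq_zero_and_pow_le_re`** (for
  `A : Matrix m m ℂ` Hermitian and `γ`-coercive with `0 ≤ γ`: `(det A).im = 0 ∧ γ^{card m} ≤ (det A).re`), `coercivity_letter_pos` (the floor
  `0 < m⋆ ≤ (γ − card·ϑ·R′ k)∕2` with `0 ≤ ϑ` read off `hrd` when `mI` is inhabited, `0 ≤ R′`, forces `0 < γ`), and the producer
  `hctr_of_hermitian` = S30's 4-clause `hctr` at `d₀ Z j := γ Z j ^ card (mI Z j)` from (i) `hent` ∧ `hherm` ∧ (iv) `hco`.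
* §2 (kernel) **`attachedPart_locE_le_of_coreLettersOf_herm`** ∕ **`muPart_locE_le_of_coreLettersOf_herm`** — S32's two ENDs ONCE BY NAME each with
  `d₀ := fun Z j => γ Z j ^ card (mI Z j)`, `hd₀` PROVED (`pow_pos`), `hctr` PRODUCED by §1; DISPLAYED INSTEAD: `hent` (entry bound at the centres),
  **`hherm`** (the centre reading is Hermitian — a TYPE hypothesis on the substrate's tables `base`∕`rd` at the class centres), `hco` (γ-coercivity);
  `hbud` and `hF3`'s letter `N₀f` re-lettered at `d₀ := γ^{card}` (`detBudget (card mI) β₀ ϑ (R′ k) < γ^{card}`,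
  `N₀f = gaussC·√(max 1 (card!·β₀^{card} + γ^{card}))`); every other binder VERBATIM S32's; conclusions LITERALLY S32's = S30's = N0r's.
  CENSUS vs S32 §2: MINUS = [`d₀` (:= γ^card), `hd₀` (proved), `hctr`]; PLUS = [`hent`, `hherm`, `hco`]; rest IDENTICAL up to the re-lettering.

WHAT IT SAYS (wording offered for the typer): «for a HERMITIAN centre reading the substrate's displayed centre conditions of S30 shrink to the entry
bound, Hermitian symmetry and γ-coercivity — the two determinant clauses and the letter `d₀` are KERNEL consequences (`d₀ := γ^{card}`,
eigenvalue ≥ γ, det = Π eigenvalues); whether Bałaban's (2.14) covariance tables at the class centres ARE Hermitian∕real-symmetric and γ-coercive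
is the substrate's displayed identification ((2.15)–(2.17) KIND), NOT claimed; no numeral of print; 0 binders instantiated on Bałaban's densities;
no wall item discharged; wall v1.7 (T4-DAG v43) does NOT move; R-t4r2-Q2 NOT met thereby; NE1′ NOT proved ∕ NOT printed».  TYPER RIDER (R-T124
(iii), verbatim): «`hent`∕`hherm`∕`hco` are TYPE hypotheses on the substrate's displayed tables `base`∕`rd` at the class centres; whether Bałaban's
(2.14)–(2.17) covariances ARE Hermitian and γ-coercive there is the SUBSTRATE's identification, NOT claimed; `d₀ := γ^{card}` is OUR letter; no
numeral of print».

HONEST FRAMING.  One [folklore] finite-dimensional lemma (Mathlib's matrix spectral theorem BY NAME) + by-name composition over displayed SHAPES;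
0 estimates of print; ABSOLUTE RULE honoured.  Rung (B)+1 on ONE finite four-torus — NOT infinite volume, NOT a mass gap, NOT OS on ℝ⁴, NOT
Clay.  HONEST DEPENDENCY: continuum YM on T⁴ ⇐ BetaPertH ∧ nine spine estimates (0/9 proved); BetaPertH ⇐ (D1) ∧ (D4) ∧ CAP+tail; G-an2-4
gates asym, D1 and NE2/3/4. -/

noncomputable section

namespace Summit.QuantumFields.BalabanUV.T4Continuum.NE1p.DressedSmallFieldOnCoresSlotLettersHerm

open scoped BigOperators Matrix ComplexConjugate
open Metric Set MeasureTheory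
open Literature.MathematicalPhysics.QuantumFieldTheory.Balaban1983to89
open Literature.MathematicalPhysics.QuantumFieldTheory.Balaban1983to89.B13Resummation (locE Geometry)
open Literature.MathematicalPhysics.QuantumFieldTheory.Balaban1983to89.B5Prop11Lower (nsq)
open Summit.QuantumFields.BalabanUV.T4Continuum.B13HistMeasurable (MeasPotFrame B13HistM)
open Summit.QuantumFields.BalabanUV.T4Continuum.B13TermCoreMass (factorMass)
open Summit.QuantumFields.BalabanUV.T4Continuum.SubstrateTwoRunsDriven (DrivenRuns)
open Summit.QuantumFields.BalabanUV.T4Continuum.SubstrateActivities (coreOf actOfLetters)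
open Summit.QuantumFields.BalabanUV.T4Continuum.SubstrateGaussianLetters (gaussC linForm)
open Summit.QuantumFields.BalabanUV.T4Continuum.SubstrateGaussianLettersBall (detBudget)
open Summit.QuantumFields.BalabanUV.T4Continuum.SubstrateSlotsOfRecord (ActLetters coreLettersOf)
open Summit.QuantumFields.BalabanUV.T4Continuum.NE1p.DressedSmallFieldOnCoresSlotLettersMass (attachedPart_locE_le_of_coreLettersOf_factorMass
  muPart_locE_le_of_coreLettersOf_factorMass)

/-! ## §1 A Hermitian γ-coercive matrix has real determinant `≥ γ^{card}`; the centre conditions from Hermitian symmetry + coercivity -/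

section Lemma

variable {m : Type*} [Fintype m]

/-- `nsq` of the coordinate function of a vector of `EuclideanSpace ℂ m` is its squared norm. [folklore] -/
theorem nsq_coe_euclidean (v : EuclideanSpace ℂ m) : nsq (⇑v) = ‖v‖ ^ 2 := by
  rw [EuclideanSpace.norm_eq, Real.sq_sqrt (Finset.sum_nonneg fun i _ => sq_nonneg _)]
  rfl

variable [DecidableEq m]

/-- **A HERMITIAN `γ`-COERCIVE MATRIX HAS REAL DETERMINANT AT LEAST `γ^{card m}`** (`0 ≤ γ`): every eigenvalue is the Rayleigh quotient at a
unit eigenvector (`Matrix.IsHermitian.eigenvalues_eq`, `eigenvectorBasis` orthonormal), hence `≥ γ` by coercivity; the determinant is the product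
of the eigenvalues (`Matrix.IsHermitian.det_eq_prod_eigenvalues`), hence real with real part `≥ γ^{card m}`. [folklore] -/
theorem det_im_eq_zero_and_pow_le_re {A : Matrix m m ℂ} (hA : A.IsHermitian) {γ : ℝ} (hγ : 0 ≤ γ)
    (hco : ∀ x : m → ℂ, γ * nsq x ≤ (star x ⬝ᵥ (A *ᵥ x)).re) :
    (A.det).im = 0 ∧ γ ^ Fintype.card m ≤ (A.det).re := by
  have hev : ∀ i, γ ≤ hA.eigenvalues i := by
    intro i
    have h1 : nsq (⇑(hA.eigenvectorBasis i)) = 1 := by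
      rw [nsq_coe_euclidean, hA.eigenvectorBasis.orthonormal.1 i, one_pow]
    have h := hco (⇑(hA.eigenvectorBasis i))
    rw [h1, mul_one] at h
    rw [hA.eigenvalues_eq i]
    exact h
  have hdet : A.det = ((∏ i, hA.eigenvalues i : ℝ) : ℂ) := by
    rw [hA.det_eq_prod_eigenvalues, Complex.ofReal_prod]; rfl
  rw [hdet]
  refine ⟨Complex.ofReal_im _, ?_⟩
  rw [Complex.ofReal_re, ← Finset.card_univ, ← Finset.prod_const]
  exact Finset.prod_le_prod (fun _ _ => hγ) fun i _ => hev i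

end Lemma

section Letters

variable {G : Type} [GaugeGroup G] (D : DrivenRuns G) (P : MeasPotFrame D.carriers)
variable (Op : Type) [NormedAddCommGroup Op] [NormedSpace ℂ Op] {J : Type}
  (𝒵 : D.carriers.Dom → J → Type) [∀ Z j, Fintype (𝒵 Z j)] (dom : ∀ Z j, 𝒵 Z j → D.carriers.Dom)
  (Jc : D.carriers.Dom → J → Type) [∀ Z j, Fintype (Jc Z j)]
  (V : D.carriers.Dom → J → Type) [∀ Z j, NormedAddCommGroup (V Z j)] [∀ Z j, InnerProductSpace ℝ (V Z j)]
  [∀ Z j, MeasurableSpace (V Z j)] [∀ Z j, BorelSpace (V Z j)] [∀ Z j, FiniteDimensional ℝ (V Z j)]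
  (mI : D.carriers.Dom → J → Type) [∀ Z j, Fintype (mI Z j)] [∀ Z j, DecidableEq (mI Z j)]

omit [∀ Z j, Fintype (𝒵 Z j)] [∀ Z j, Fintype (Jc Z j)] [∀ Z j, BorelSpace (V Z j)] [∀ Z j, FiniteDimensional ℝ (V Z j)]
  [∀ Z j, DecidableEq (mI Z j)] in
/-- **THE COERCIVITY LETTER IS POSITIVE UNDER THE FLOOR** (kernel): `0 < m⋆ ≤ (γ Z j − card (mI Z j)·ϑ Z j·R′ k)∕2` with `0 ≤ R′ k` and the
read-out bound `‖rd a ii jj‖ ≤ ϑ Z j` (so `0 ≤ ϑ Z j` as soon as `mI Z j` is inhabited; for empty `mI Z j` the product vanishes) give `0 < γ Z j`.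
[folklore] -/
theorem coercivity_letter_pos (A : ∀ Z j, ActLetters D P Op 𝒵 dom Jc V mI Z j) {ϑ γ : D.carriers.Dom → J → ℝ} {R' : ℕ → ℝ} {mstar : ℝ}
    (hR' : ∀ k, 0 ≤ R' k) (hrd : ∀ Z j a ii jj, ‖(A Z j).rd a ii jj‖ ≤ ϑ Z j) (hmstar : 0 < mstar)
    (hfloor : ∀ k Z j, mstar ≤ (γ Z j - Fintype.card (mI Z j) * ϑ Z j * R' k) / 2) (Z : D.carriers.Dom) (j : J) : 0 < γ Z j := by
  have hc : 0 ≤ (Fintype.card (mI Z j) : ℝ) * ϑ Z j * R' 0 := by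
    rcases isEmpty_or_nonempty (mI Z j) with h | ⟨⟨ii⟩⟩
    · simp [Fintype.card_eq_zero]
    · exact mul_nonneg (mul_nonneg (Nat.cast_nonneg _) ((norm_nonneg _).trans (hrd Z j (fun _ => (0, 0)) ii ii))) (hR' 0)
  have h := hfloor 0 Z j
  linarith

omit [∀ Z j, Fintype (𝒵 Z j)] [∀ Z j, Fintype (Jc Z j)] [∀ Z j, BorelSpace (V Z j)] [∀ Z j, FiniteDimensional ℝ (V Z j)] in
/-- **S30's CENTRE CONDITIONS FROM HERMITIAN SYMMETRY + COERCIVITY** (kernel; `det_im_eq_zero_and_pow_le_re` at every class centre): with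
`d₀ Z j := γ Z j ^ card (mI Z j)`, S30's 4-clause binder `hctr` (entries `≤ β₀` ∧ det real ∧ `d₀ ≤ Re det` ∧ `γ`-coercive) follows from the entry
bound `hent`, the Hermitian symmetry `hherm` of the centre reading and its `γ`-coercivity `hco` (`0 ≤ γ`). [folklore] -/
theorem hctr_of_hermitian {W : Set (ℕ → ℝ)} {ctr : ℕ → (ℕ → ℝ) → D.carriers.BgB → Op × B13HistM P}
    (A : ∀ Z j, ActLetters D P Op 𝒵 dom Jc V mI Z j) {β₀ γ : D.carriers.Dom → J → ℝ} (hγ : ∀ Z j, 0 ≤ γ Z j)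
    (hent : ∀ k, ∀ g ∈ W, ∀ (U : D.carriers.BgB) (Z : D.carriers.Dom) (j : J) (a : (Jc Z j ⊕ 𝒵 Z j) → ℝ × ℝ) ii jj,
      ‖linForm (A Z j).base (A Z j).rd (ctr k g U).1 a ii jj‖ ≤ β₀ Z j)
    (hherm : ∀ k, ∀ g ∈ W, ∀ (U : D.carriers.BgB) (Z : D.carriers.Dom) (j : J) (a : (Jc Z j ⊕ 𝒵 Z j) → ℝ × ℝ),
      (linForm (A Z j).base (A Z j).rd (ctr k g U).1 a).IsHermitian)
    (hco : ∀ k, ∀ g ∈ W, ∀ (U : D.carriers.BgB) (Z : D.carriers.Dom) (j : J) (a : (Jc Z j ⊕ 𝒵 Z j) → ℝ × ℝ) (x : mI Z j → ℂ),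
      γ Z j * nsq x ≤ (star x ⬝ᵥ (linForm (A Z j).base (A Z j).rd (ctr k g U).1 a *ᵥ x)).re) :
    ∀ k, ∀ g ∈ W, ∀ (U : D.carriers.BgB) (Z : D.carriers.Dom) (j : J) (a : (Jc Z j ⊕ 𝒵 Z j) → ℝ × ℝ),
      (∀ ii jj, ‖linForm (A Z j).base (A Z j).rd (ctr k g U).1 a ii jj‖ ≤ β₀ Z j) ∧
      ((linForm (A Z j).base (A Z j).rd (ctr k g U).1 a).det).im = 0 ∧
      γ Z j ^ Fintype.card (mI Z j) ≤ ((linForm (A Z j).base (A Z j).rd (ctr k g U).1 a).det).re ∧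
      (∀ x : mI Z j → ℂ, γ Z j * nsq x ≤ (star x ⬝ᵥ (linForm (A Z j).base (A Z j).rd (ctr k g U).1 a *ᵥ x)).re) :=
  fun k g hg U Z j a =>
    ⟨hent k g hg U Z j a, (det_im_eq_zero_and_pow_le_re (hherm k g hg U Z j a) (hγ Z j) (hco k g hg U Z j a)).1,
      (det_im_eq_zero_and_pow_le_re (hherm k g hg U Z j a) (hγ Z j) (hco k g hg U Z j a)).2, hco k g hg U Z j a⟩

/-! ## §2 S32's two slot ENDs with the centre conditions reduced to entry bound + Hermitian symmetry + coercivity -/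

variable (𝔇 : LocDomainSys) {Cube : Type} [DecidableEq Cube] (Ge : Geometry 𝔇 Cube)

open Classical in
/-- **THE ATTACHED PART OF THE SLOT ACTIVITIES AT THE CORE LETTERS OF RECORD, HERMITIAN CENTRE** (kernel; S32 §2
`attachedPart_locE_le_of_coreLettersOf_factorMass` ONCE BY NAME at `d₀ := fun Z j => γ Z j ^ card (mI Z j)`, with `hd₀` PROVED (`pow_pos` ∘
`coercivity_letter_pos`) and `hctr` PRODUCED by `hctr_of_hermitian`).  Binders = S32's VERBATIM except `hctr ↦ (hent, hherm, hco)`, `d₀`∕`hd₀` gone,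
`hbud` and `hF3`'s `N₀f` read at `d₀ := γ^{card}`; conclusion LITERALLY S32's = S30's = N0r's. [folklore] -/
theorem attachedPart_locE_le_of_coreLettersOf_herm {W : Set (ℕ → ℝ)} {ctr : ℕ → (ℕ → ℝ) → D.carriers.BgB → Op × B13HistM P}
    {ROp RHist R' : ℕ → ℝ} (A : ∀ Z j, ActLetters D P Op 𝒵 dom Jc V mI Z j) {β₀ ϑ γ : D.carriers.Dom → J → ℝ} {mstar : ℝ}
    (hroom : ∀ k, ROp k < R' k) (hR' : ∀ k, 0 ≤ R' k)
    (hbase : ∀ Z j ii jj, Measurable fun a => (A Z j).base a ii jj)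
    (hrdm : ∀ Z j ii jj (o' : Op), Measurable fun a => (A Z j).rd a ii jj o')
    (hβ₀ : ∀ Z j, 0 ≤ β₀ Z j) (hrd : ∀ Z j a ii jj, ‖(A Z j).rd a ii jj‖ ≤ ϑ Z j)
    -- the REDUCED centre conditions: entry bound, Hermitian symmetry, γ-coercivity at every class centre
    (hent : ∀ k, ∀ g ∈ W, ∀ (U : D.carriers.BgB) (Z : D.carriers.Dom) (j : J) (a : (Jc Z j ⊕ 𝒵 Z j) → ℝ × ℝ) ii jj,
      ‖linForm (A Z j).base (A Z j).rd (ctr k g U).1 a ii jj‖ ≤ β₀ Z j)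
    (hherm : ∀ k, ∀ g ∈ W, ∀ (U : D.carriers.BgB) (Z : D.carriers.Dom) (j : J) (a : (Jc Z j ⊕ 𝒵 Z j) → ℝ × ℝ),
      (linForm (A Z j).base (A Z j).rd (ctr k g U).1 a).IsHermitian)
    (hco : ∀ k, ∀ g ∈ W, ∀ (U : D.carriers.BgB) (Z : D.carriers.Dom) (j : J) (a : (Jc Z j ⊕ 𝒵 Z j) → ℝ × ℝ) (x : mI Z j → ℂ),
      γ Z j * nsq x ≤ (star x ⬝ᵥ (linForm (A Z j).base (A Z j).rd (ctr k g U).1 a *ᵥ x)).re)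
    (hbud : ∀ k Z j, detBudget (Fintype.card (mI Z j)) (β₀ Z j) (ϑ Z j) (R' k) < γ Z j ^ Fintype.card (mI Z j))
    (hmstar : 0 < mstar) (hfloor : ∀ k Z j, mstar ≤ (γ Z j - Fintype.card (mI Z j) * ϑ Z j * R' k) / 2)
    {k : ℕ} {g : ℕ → ℝ} (hg : g ∈ W) {U : D.carriers.BgB} {o : Op} {h₀ w : B13HistM P} {ϱ : ℝ}
    (hO : ‖o - (ctr k g U).1‖ ≤ ROp k) (hH : ‖h₀ - (ctr k g U).2‖ + ϱ * ‖w‖ ≤ RHist k)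
    {emb : 𝔇.Dom → D.carriers.Dom} (hscale : ∀ Z, D.carriers.scale (emb Z) = k)
    (terms : 𝔇.Dom → Finset (D.carriers.Dom × J))
    {A₀ A₁ R r₁ b₅ : ℝ} {X₀ : 𝔇.Dom} (hA₀ : 0 ≤ A₀) (hA₁ : 0 ≤ A₁) (hr₁ : 0 ≤ r₁) (hb : r₁ * 5 ≤ b₅)
    (hrate : r₁ + 2 * Ge.κ₀ + 2 ≤ R) (hsmall : (A₀ + ϱ * A₁) * Real.exp (b₅ + 1) * Ge.K₀ * Ge.ν * Ge.c₁ ≤ 1)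
    (hF3 : ∀ Z, Ge.cubes Z ⊆ Ge.cubes X₀ →
      ∑ p ∈ terms Z, factorMass (fun Z j => coreOf P Op 𝒵 dom Jc V (coreLettersOf D P Op 𝒵 dom Jc V mI A) Z j)
          (fun Z j => gaussC (mI Z j) * Real.sqrt (max 1 ((Fintype.card (mI Z j)).factorial * β₀ Z j ^ Fintype.card (mI Z j) +
            γ Z j ^ Fintype.card (mI Z j))))
          (fun _ _ => 0) mstar (‖h₀‖ + ϱ * ‖w‖) p.1 p.2 ≤ (A₀ + ϱ * A₁) * Real.exp (-(R * 𝔇.dj Z)))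
    (hϱ : 2 ≤ ϱ) (hϱA : A₀ ≤ ϱ * A₁) :
    ‖locE Ge.ι Ge.cubes (fun Z => ∑ p ∈ terms Z,
          actOfLetters P Op 𝒵 dom Jc V (coreLettersOf D P Op 𝒵 dom Jc V mI A) p.1 p.2 o (h₀ + w)) (Ge.cubes X₀) -
        locE Ge.ι Ge.cubes (fun Z => ∑ p ∈ terms Z,
          actOfLetters P Op 𝒵 dom Jc V (coreLettersOf D P Op 𝒵 dom Jc V mI A) p.1 p.2 o h₀) (Ge.cubes X₀)‖ ≤
      4 * (Real.exp 1 * Ge.ν * Ge.c₁ * Ge.K₀ ^ 2) * A₁ * Real.exp (-(r₁ * 𝔇.dj X₀)) :=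
  attachedPart_locE_le_of_coreLettersOf_factorMass D P Op 𝒵 dom Jc V mI 𝔇 Ge A
    (d₀ := fun Z j => γ Z j ^ Fintype.card (mI Z j)) hroom hR' hbase hrdm hβ₀
    (fun Z j => pow_pos (coercivity_letter_pos D P Op 𝒵 dom Jc V mI A hR' hrd hmstar hfloor Z j) _) hrd
    (hctr_of_hermitian D P Op 𝒵 dom Jc V mI A
      (fun Z j => (coercivity_letter_pos D P Op 𝒵 dom Jc V mI A hR' hrd hmstar hfloor Z j).le) hent hherm hco)
    hbud hmstar hfloor hg hO hH hscale terms hA₀ hA₁ hr₁ hb hrate hsmall hF3 hϱ hϱA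

open Classical in
/-- **THE μ-PART OF THE SAME, HERMITIAN CENTRE** (kernel; S32 §2 `muPart_locE_le_of_coreLettersOf_factorMass` ONCE BY NAME, centre conditions reduced
as above). [folklore] -/
theorem muPart_locE_le_of_coreLettersOf_herm {W : Set (ℕ → ℝ)} {ctr : ℕ → (ℕ → ℝ) → D.carriers.BgB → Op × B13HistM P}
    {ROp RHist R' : ℕ → ℝ} (A : ∀ Z j, ActLetters D P Op 𝒵 dom Jc V mI Z j) {β₀ ϑ γ : D.carriers.Dom → J → ℝ} {mstar : ℝ}
    (hroom : ∀ k, ROp k < R' k) (hR' : ∀ k, 0 ≤ R' k)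
    (hbase : ∀ Z j ii jj, Measurable fun a => (A Z j).base a ii jj)
    (hrdm : ∀ Z j ii jj (o' : Op), Measurable fun a => (A Z j).rd a ii jj o')
    (hβ₀ : ∀ Z j, 0 ≤ β₀ Z j) (hrd : ∀ Z j a ii jj, ‖(A Z j).rd a ii jj‖ ≤ ϑ Z j)
    (hent : ∀ k, ∀ g ∈ W, ∀ (U : D.carriers.BgB) (Z : D.carriers.Dom) (j : J) (a : (Jc Z j ⊕ 𝒵 Z j) → ℝ × ℝ) ii jj,
      ‖linForm (A Z j).base (A Z j).rd (ctr k g U).1 a ii jj‖ ≤ β₀ Z j)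
    (hherm : ∀ k, ∀ g ∈ W, ∀ (U : D.carriers.BgB) (Z : D.carriers.Dom) (j : J) (a : (Jc Z j ⊕ 𝒵 Z j) → ℝ × ℝ),
      (linForm (A Z j).base (A Z j).rd (ctr k g U).1 a).IsHermitian)
    (hco : ∀ k, ∀ g ∈ W, ∀ (U : D.carriers.BgB) (Z : D.carriers.Dom) (j : J) (a : (Jc Z j ⊕ 𝒵 Z j) → ℝ × ℝ) (x : mI Z j → ℂ),
      γ Z j * nsq x ≤ (star x ⬝ᵥ (linForm (A Z j).base (A Z j).rd (ctr k g U).1 a *ᵥ x)).re)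
    (hbud : ∀ k Z j, detBudget (Fintype.card (mI Z j)) (β₀ Z j) (ϑ Z j) (R' k) < γ Z j ^ Fintype.card (mI Z j))
    (hmstar : 0 < mstar) (hfloor : ∀ k Z j, mstar ≤ (γ Z j - Fintype.card (mI Z j) * ϑ Z j * R' k) / 2)
    {k : ℕ} {g : ℕ → ℝ} (hg : g ∈ W) {U : D.carriers.BgB} {o : Op} {h₀ v : B13HistM P} {μ₁ : ℝ}
    (hO : ‖o - (ctr k g U).1‖ ≤ ROp k) (hH : ‖h₀ - (ctr k g U).2‖ + μ₁ * ‖v‖ ≤ RHist k)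
    {emb : 𝔇.Dom → D.carriers.Dom} (hscale : ∀ Z, D.carriers.scale (emb Z) = k)
    (terms : 𝔇.Dom → Finset (D.carriers.Dom × J))
    {A' R r₁ b₅ μ₀ : ℝ} {X₀ : 𝔇.Dom} {sμ : ℂ} (hA : 0 ≤ A') (hr₁ : 0 ≤ r₁) (hb : r₁ * 5 ≤ b₅)
    (hrate : r₁ + 2 * Ge.κ₀ + 2 ≤ R) (hsmall : A' * Real.exp (b₅ + 1) * Ge.K₀ * Ge.ν * Ge.c₁ ≤ 1)
    (hF3 : ∀ Z, Ge.cubes Z ⊆ Ge.cubes X₀ →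
      ∑ p ∈ terms Z, factorMass (fun Z j => coreOf P Op 𝒵 dom Jc V (coreLettersOf D P Op 𝒵 dom Jc V mI A) Z j)
          (fun Z j => gaussC (mI Z j) * Real.sqrt (max 1 ((Fintype.card (mI Z j)).factorial * β₀ Z j ^ Fintype.card (mI Z j) +
            γ Z j ^ Fintype.card (mI Z j))))
          (fun _ _ => 0) mstar (‖h₀‖ + μ₁ * ‖v‖) p.1 p.2 ≤ A' * Real.exp (-(R * 𝔇.dj Z)))
    (h0 : 0 < μ₀) (h01 : μ₀ < μ₁) (hμ : ‖sμ‖ ≤ μ₀) :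
    ‖locE Ge.ι Ge.cubes (fun Z => ∑ p ∈ terms Z,
          actOfLetters P Op 𝒵 dom Jc V (coreLettersOf D P Op 𝒵 dom Jc V mI A) p.1 p.2 o (h₀ + sμ • v)) (Ge.cubes X₀) -
        locE Ge.ι Ge.cubes (fun Z => ∑ p ∈ terms Z,
          actOfLetters P Op 𝒵 dom Jc V (coreLettersOf D P Op 𝒵 dom Jc V mI A) p.1 p.2 o h₀) (Ge.cubes X₀)‖ ≤
      Real.exp 1 * Ge.ν * Ge.c₁ * Ge.K₀ ^ 2 * A' * Real.exp (-(r₁ * 𝔇.dj X₀)) * (μ₀ / (μ₁ - μ₀)) :=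
  muPart_locE_le_of_coreLettersOf_factorMass D P Op 𝒵 dom Jc V mI 𝔇 Ge A
    (d₀ := fun Z j => γ Z j ^ Fintype.card (mI Z j)) hroom hR' hbase hrdm hβ₀
    (fun Z j => pow_pos (coercivity_letter_pos D P Op 𝒵 dom Jc V mI A hR' hrd hmstar hfloor Z j) _) hrd
    (hctr_of_hermitian D P Op 𝒵 dom Jc V mI A
      (fun Z j => (coercivity_letter_pos D P Op 𝒵 dom Jc V mI A hR' hrd hmstar hfloor Z j).le) hent hherm hco)
    hbud hmstar hfloor hg hO hH hscale terms hA hr₁ hb hrate hsmall hF3 h0 h01 hμ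

end Letters

end Summit.QuantumFields.BalabanUV.T4Continuum.NE1p.DressedSmallFieldOnCoresSlotLettersHerm

end
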